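import Literature.AnabelianGeometry.EtaleTheta.Discharge.Sec5Lem59vPinGalois
import Literature.AnabelianGeometry.EtaleTheta.Discharge.Sec5ThetaSubquotientLevelNOfConnectedTemperoid
import Literature.AnabelianGeometry.EtaleTheta.Discharge.Sec5OfConnectedTemperoid
import HarnessLib
import HarnessLib.Audit.LibrarySuggestionsDenyListEtaleTheta

/-!
# [EtTh] Lemma 5.9 (v) AT THE GENUINE §5 DATA (level `N`) — the carrier head RE-KEYED to the v2 subquotient record
# `ThetaSubquotientProjGalois` (surjective at Galois objects only; proof-only)

Mochizuki, *The étale theta function and its Frobenioid-theoretic manifestations*, Publ. RIMS **45** (2009), Lemma 5.9 (v) p. 332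
(PDF p. 106): «In the situation of (iv), the cyclotomic rigidity isomorphism arising from the theory of §2 [cf. Corollary 2.19, (i)]
coincides with the Frobenioid-theoretic isomorphism of Proposition 5.5 [where we take "`S`" to be `B_N`].»
[cite: MochizukiEtTh2009, Lem 5.9 (v) p.332 (PDF p.106)]; §5 p. 327 (PDF p. 101) [cite: MochizukiEtTh2009, §5 p.327 (PDF p.101)].

abc-iut cell, layer L2, seat abc-iut-w6-d079 (gen 6), row «PROJ-SURJ-PLAN-A» step (3), CARRIER form (abc-iut-L2-lead gen 6 R847 named
p471697 / p472053 as candidate heads).  PROOF-ONLY (0 definitions); the sequel of `Sec5Lem59vPinGalois.lean` (p482077: the GENERIC head re-keyed).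
Here abc-iut-w4-d042's CARRIER head `cycRigidityCoincide_ofConnectedTemperoidData_levelN` (p471697) — Lemma 5.9 (v) at abc-iut-L2-t4's genuine
§5 data `ThetaFrobenioid.ofConnectedTemperoidData h (RD.levelStub ιX) …` over `B^temp(Π^tp_X)⁰`, `P` pinned at `B_N^bs` by `hPpre` — and its three
row-2 conversion lemmas are re-run VERBATIM with the binder `(P : ThetaSubquotientProj 𝔉)` (abc-iut-L2-t4's v1 record, asking surjectivity at
EVERY object) replaced by `(P : ThetaSubquotientProjGalois 𝔉 Gal)` (abc-iut-w6-d079's v2 record p481123, surjectivity at `Gal` objects only,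
INHABITED at abc-iut-L2-t9's R2 carriers by p481568) and Prop. 5.5 read on the v2 record (`ThetaSubquotientProjGalois.IsKummerDetermined`,
the same formula).  Nothing of p471697 is edited; its v1 head remains the `P.toGalois` instance of the new one (twin check in p482077).

* `rowTwoPre_id_ofConnectedTemperoidData_levelN_galois`, `rowTwoLift_id_…_galois`, `rowTwoLaw_id_…_galois` — the row-2 laws hpre / hlift / hP
  at the genuine data through the pin `hPpre`, on the v2 record;
* **`cycRigidityCoincide_ofConnectedTemperoidData_levelN_galois`** — THE CARRIER HEAD on the v2 record.

HONEST FRAMING: kernel-checked implications between the cell's typed statements; nothing asserts that such data exist for an actual curve;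
[EtTh] is refereed; nothing here bears on [IUTchIII] Cor. 3.12 — no side taken; typed ≠ proved.
-/

noncomputable section

namespace Literature.AnabelianGeometry.EtaleTheta

open CategoryTheory Opposite FrobenioidCyclotomicRigidity Literature.AlgebraicGeometry.Frobenioids
  Literature.AnabelianGeometry.SemiGraphs Literature.AnabelianGeometry.SemiGraphs.GaloisObjects

namespace ThetaFrobenioid

universe u₀ v₀ w' v₁ u₁

section Connected

variable {K : Type u₀} [Field K] {X : SemiGraphs.TemperedArithmeticGroup.{u₀} K} {D₀ : Type u₀} [Category.{v₀} D₀]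
  {V : FrdIMonoidStub.{max u₀ w'}} {T₀ : RealifiedDivisorMonoids (D₀ := D₀) V}
  {VD : FrdICatStub.{u₀ + 1, u₀, max u₀ w'} (ConnectedPart (BTemp X.Pi))}
  {tf : TemperedFrobenioid T₀ (ConnectedPart (BTemp X.Pi)) VD} {hZ : tf.monoidType = MonoidType.Z}
  {hP : ∀ A : (ConnectedPart (BTemp X.Pi))ᵒᵖ, IsPerfect (tf.Φ.carrier A)}
  {NH : Subgroup (Field.absoluteGaloisGroup K) → tf.category → ℕ+ → Prop} {A₀ : tf.category}
  {hA₀ : PreFrobenioid.IsFrobeniusTrivial tf.toElem A₀} {hA₀' : SemiGraphs.IsGaloisObj A₀.base.obj}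
  {lv N : ℕ+} {l' : ℕ} {RD : RigidData.{max u₀ w'} N l'}
  {pullFrac : ∀ {A A' : (BiKummerSetting.mkOfConnectedTemperoid X tf hZ hP NH A₀ hA₀ hA₀').C} (_ : A' ⟶ A),
    (BiKummerSetting.mkOfConnectedTemperoid X tf hZ hP NH A₀ hA₀ hA₀').biratUnits A →
      (BiKummerSetting.mkOfConnectedTemperoid X tf hZ hP NH A₀ hA₀ hA₀').biratUnits A'}
  {θ : (BiKummerSetting.mkOfConnectedTemperoid X tf hZ hP NH A₀ hA₀ hA₀').biratUnits
    (BiKummerSetting.mkOfConnectedTemperoid X tf hZ hP NH A₀ hA₀ hA₀').Aodot}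
  {Bl : (BiKummerSetting.mkOfConnectedTemperoid X tf hZ hP NH A₀ hA₀ hA₀').C}
  {Pl : (BiKummerSetting.mkOfConnectedTemperoid X tf hZ hP NH A₀ hA₀ hA₀').FractionPair θ Bl}
  {Rl : (BiKummerSetting.mkOfConnectedTemperoid X tf hZ hP NH A₀ hA₀ hA₀').NthRoot θ Pl lv pullFrac}
  (h : ModelFrobenioid.Hypotheses tf.divisorMonoid tf.ratFnFunctor)
  (odd_l : Odd (lv : ℕ))
  (R : (BiKummerSetting.mkOfConnectedTemperoid X tf hZ hP NH A₀ hA₀ hA₀').NthRoot Rl.root Rl.pair N pullFrac)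
  (ιX : RD.PiX ≃ₜ* X.Pi) (K' : Type (max u₀ w')) [Field K'] (constEmb : K'ˣ →* tf.biratUnitsModel R.BN)
  (constEmb_injective : Function.Injective constEmb)
  (hinvc : ∀ g : Aut R.AN.base,
    pull tf.divisorMonoid g.hom (ModelFrobenioid.div R.pair.num) = ModelFrobenioid.div R.pair.num)
  (hinvp : ∀ y : RD.PiX, y ∈ RD.PiYdd →
    pull tf.divisorMonoid ((BiKummerSetting.mkOfConnectedTemperoid X tf hZ hP NH A₀ hA₀ hA₀').galoisSurj R.AN.base
      R.αData.isGalois (ιX y)).hom (ModelFrobenioid.div R.pair.den) = ModelFrobenioid.div R.pair.den)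
  [RD.iotaN.range.Normal]


variable {Gal : ConnectedPart (BTemp X.Pi) → Prop}

/-! ### The row-2 laws at the genuine data, ON THE v2 RECORD `ThetaSubquotientProjGalois … Gal`, in the currency of the generic pin files (`ι := id`)

Three definitional conversions (`ofBiKummerData_PiX` / `_PiYdd` are `rfl`; `𝔉.ρ = rhoOfBiKummerData R ιX`, `𝔉.base.obj 𝔉.BN = B_N^bs`),
stated as separate declarations and consumed with EXPLICIT universes: at this four-deep carrier the monolithic elaboration of the consumer
with these conversions inlined does not terminate in reasonable time (cf. the elaboration notes of `Sec5Thm56EndKnitLevelNCarrier`). -/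

/-- **hpre** at the genuine data, binding the v2 record (abc-iut-w4-d042's `rowTwoPre_id_…_levelN` VERBATIM on `P : ThetaSubquotientProjGalois _ Gal`) (pin `hPpre`; this seat's `mapAut_rho_mem_autPre_of_coe_mem_lDeltaTheta`, p431034), read with `ι := id`:
`k ∈ Π^tp_Ÿ̲`, `id k ∈ (l·Δ_Θ) ⇒ ρ k ∈ P.pre B_N`.  [cite: MochizukiEtTh2009, Prop 5.5 p.327 (PDF p.101)] -/
theorem rowTwoPre_id_ofConnectedTemperoidData_levelN_galois (P : ThetaSubquotientProjGalois (ofConnectedTemperoidData h (RD.levelStub ιX) odd_l R ιX K' constEmb constEmb_injective hinvc hinvp) Gal)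
    (hPpre : P.pre R.BN.base =
      (ThetaSubquotient.autPre (RD.qN ιX) RD.iotaN R.BN.base.obj).comap (Functor.mapAut R.BN.base (connectedObjects (BTemp X.Pi)).ι)) :
    ∀ k : (ofConnectedTemperoidData h (RD.levelStub ιX) odd_l R ιX K' constEmb constEmb_injective hinvc hinvp).PiYdd, (ContinuousMulEquiv.refl _ : (ofConnectedTemperoidData h (RD.levelStub ιX) odd_l R ιX K' constEmb constEmb_injective hinvc hinvp).PiX ≃ₜ* RD.toThetaEnvData.PiX) (k : (ofConnectedTemperoidData h (RD.levelStub ιX) odd_l R ιX K' constEmb constEmb_injective hinvc hinvp).PiX) ∈ RD.lDeltaTheta → (ofConnectedTemperoidData h (RD.levelStub ιX) odd_l R ιX K' constEmb constEmb_injective hinvc hinvp).ρ (k : (ofConnectedTemperoidData h (RD.levelStub ιX) odd_l R ιX K' constEmb constEmb_injective hinvc hinvp).PiX) ∈ P.pre ((ofConnectedTemperoidData h (RD.levelStub ιX) odd_l R ιX K' constEmb constEmb_injective hinvc hinvp).base.obj (ofConnectedTemperoidData h (RD.levelStub ιX) odd_l R ιX K' constEmb constEmb_injective hinvc hinvp).BN)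 := by
  have hpre : ∀ k : RD.PiYdd, (k : RD.PiX) ∈ RD.lDeltaTheta → rhoOfBiKummerData R ιX k ∈ P.pre R.BN.base := by
    intro k hk
    rw [hPpre]
    exact mapAut_rho_mem_autPre_of_coe_mem_lDeltaTheta R ιX k hk
  exact fun k hk => hpre k hk

omit [RD.iotaN.range.Normal] in
/-- **hlift** at the genuine data, binding the v2 record (abc-iut-w4-d042's `rowTwoLift_id_…_levelN` VERBATIM) (pin `hPpre`): an element of `H_{B_N} = ρ(Π^tp_Ÿ)` in `P.pre B_N` IS `ρ k` for some `k ∈ Π^tp_Ÿ ∩ (l·Δ_Θ)` — every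
element of `P_{B_N^bs}` already is (this seat's `exists_mem_lDeltaTheta_mapAut_rho_eq_of_mem_autPre`, p431034; `(l·Δ_Θ) ≤ Π^tp_Ÿ`), so NO lift
inside `H_⊙` and no `A_⊙^bs := Ÿ` restriction is needed.  [cite: MochizukiEtTh2009, Prop 5.5 proof p.327–328 (PDF pp.101–102)] -/
theorem rowTwoLift_id_ofConnectedTemperoidData_levelN_galois (P : ThetaSubquotientProjGalois (ofConnectedTemperoidData h (RD.levelStub ιX) odd_l R ιX K' constEmb constEmb_injective hinvc hinvp) Gal)
    (hPpre : P.pre R.BN.base =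
      (ThetaSubquotient.autPre (RD.qN ιX) RD.iotaN R.BN.base.obj).comap (Functor.mapAut R.BN.base (connectedObjects (BTemp X.Pi)).ι)) :
    ∀ a ∈ (ofConnectedTemperoidData h (RD.levelStub ιX) odd_l R ιX K' constEmb constEmb_injective hinvc hinvp).HB, a ∈ P.pre ((ofConnectedTemperoidData h (RD.levelStub ιX) odd_l R ιX K' constEmb constEmb_injective hinvc hinvp).base.obj (ofConnectedTemperoidData h (RD.levelStub ιX) odd_l R ιX K' constEmb constEmb_injective hinvc hinvp).BN) →
      ∃ k : (ofConnectedTemperoidData h (RD.levelStub ιX) odd_l R ιX K' constEmb constEmb_injective hinvc hinvp).PiYdd, (ContinuousMulEquiv.refl _ : (ofConnectedTemperoidData h (RD.levelStub ιX) odd_l R ιX K' constEmb constEmb_injective hinvc hinvp).PiX ≃ₜ* RD.toThetaEnvData.PiX) (k : (ofConnectedTemperoidData h (RD.levelStub ιX) odd_l R ιX K' constEmb constEmb_injective hinvc hinvp).PiX) ∈ RD.lDeltaTheta ∧ (ofConnectedTemperoidData h (RD.levelStub ιX) odd_l R ιX K' constEmb constEmb_injective hinvc hinvp).ρ (k : (ofConnectedTemperoidData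 h (RD.levelStub ιX) odd_l R ιX K' constEmb constEmb_injective hinvc hinvp).PiX) = a := by
  have hlift : ∀ a ∈ (ofConnectedTemperoidData h (RD.levelStub ιX) odd_l R ιX K' constEmb constEmb_injective hinvc hinvp).HB, a ∈ P.pre R.BN.base →
      ∃ k : RD.PiYdd, (k : RD.PiX) ∈ RD.lDeltaTheta ∧ rhoOfBiKummerData R ιX k = a := by
    intro a ha hm
    change a ∈ RD.PiYdd.map (rhoOfBiKummerData R ιX) at ha
    obtain ⟨k₀, -, rfl⟩ := ha
    have hm' : ((Functor.mapAut R.BN.base (connectedObjects (BTemp X.Pi)).ι).comp (rhoOfBiKummerData R ιX)) k₀ ∈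
        ThetaSubquotient.autPre (RD.qN ιX) RD.iotaN R.BN.base.obj := by
      rw [hPpre] at hm
      exact hm
    obtain ⟨k, hk, hρk⟩ := exists_mem_lDeltaTheta_mapAut_rho_eq_of_mem_autPre R ιX hm'
    exact ⟨⟨k, (RD.lDeltaTheta_le hk).1⟩, hk, rho_eq_of_mapAut_rho_eq R ιX hρk⟩
  exact fun a ha hm => hlift a ha hm

omit [RD.iotaN.range.Normal] in
/-- **hP** at the genuine data, binding the v2 record (abc-iut-w4-d042's `rowTwoLaw_id_…_levelN` VERBATIM): the §2 law of `ψ` in the K4 knit's currency (`ψ[proj(ρ k)] = θ-mod(k)`, `k : Π^tp_Ÿ` of the rigid data) gives the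
row-2 law of the generic pin files (`[proj(ρ k)] = ψ⁻¹(θ-mod(id k))`, `k : Π^tp_Ÿ̲` of the §5 data).  [cite: MochizukiEtTh2009, Lem 5.9 (v) p.332 (PDF p.106)] -/
theorem rowTwoLaw_id_ofConnectedTemperoidData_levelN_galois (P : ThetaSubquotientProjGalois (ofConnectedTemperoidData h (RD.levelStub ιX) odd_l R ιX K' constEmb constEmb_injective hinvc hinvp) Gal)
    (ψ : (ofConnectedTemperoidData h (RD.levelStub ιX) odd_l R ιX K' constEmb constEmb_injective hinvc hinvp).lDeltaModN (ofConnectedTemperoidData h (RD.levelStub ιX) odd_l R ιX K' constEmb constEmb_injective hinvc hinvp).BN ≃* RD.mu)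
    (hψ : ∀ (k : RD.PiYdd) (hk : (k : RD.PiX) ∈ RD.lDeltaTheta) (hm : rhoOfBiKummerData R ιX k ∈ P.pre _),
      ψ (QuotientGroup.mk (P.proj _ ⟨rhoOfBiKummerData R ιX k, hm⟩) : (ofConnectedTemperoidData h (RD.levelStub ιX) odd_l R ιX K' constEmb constEmb_injective hinvc hinvp).lDeltaModN (ofConnectedTemperoidData h (RD.levelStub ιX) odd_l R ιX K' constEmb constEmb_injective hinvc hinvp).BN) = RD.thetaMod ⟨k, hk⟩)
    (k : (ofConnectedTemperoidData h (RD.levelStub ιX) odd_l R ιX K' constEmb constEmb_injective hinvc hinvp).PiYdd) (hk : (ContinuousMulEquiv.refl _ : (ofConnectedTemperoidData h (RD.levelStub ιX) odd_l R ιX K' constEmb constEmb_injective hinvc hinvp).PiX ≃ₜ* RD.toThetaEnvData.PiX) (k : (ofConnectedTemperoidData h (RD.levelStub ιX) odd_l R ιX K' constEmb constEmb_injective hinvc hinvp).PiX) ∈ RD.lDeltaTheta)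
    (hm : (ofConnectedTemperoidData h (RD.levelStub ιX) odd_l R ιX K' constEmb constEmb_injective hinvc hinvp).ρ (k : (ofConnectedTemperoidData h (RD.levelStub ιX) odd_l R ιX K' constEmb constEmb_injective hinvc hinvp).PiX) ∈ P.pre ((ofConnectedTemperoidData h (RD.levelStub ιX) odd_l R ιX K' constEmb constEmb_injective hinvc hinvp).base.obj (ofConnectedTemperoidData h (RD.levelStub ιX) odd_l R ιX K' constEmb constEmb_injective hinvc hinvp).BN)) :
    (QuotientGroup.mk (P.proj _ ⟨(ofConnectedTemperoidData h (RD.levelStub ιX) odd_l R ιX K' constEmb constEmb_injective hinvc hinvp).ρ (k : (ofConnectedTemperoidData h (RD.levelStub ιX) odd_l R ιX K' constEmb constEmb_injective hinvc hinvp).PiX), hm⟩) : (ofConnectedTemperoidData h (RD.levelStub ιX) odd_l R ιX K' constEmb constEmb_injective hinvc hinvp).lDeltaModN (ofConnectedTemperoidData h (RD.levelStub ιX) odd_l R ιX K' constEmb constEmb_injective hinvc hinvp).BN) =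
      ψ.symm (RD.thetaMod ⟨(ContinuousMulEquiv.refl _ : (ofConnectedTemperoidData h (RD.levelStub ιX) odd_l R ιX K' constEmb constEmb_injective hinvc hinvp).PiX ≃ₜ* RD.toThetaEnvData.PiX) (k : (ofConnectedTemperoidData h (RD.levelStub ιX) odd_l R ιX K' constEmb constEmb_injective hinvc hinvp).PiX), hk⟩) :=
  ψ.eq_symm_apply.mpr (hψ k hk hm)

/-! ### Lemma 5.9 (v) at the genuine data -/

-- `linter.unusedSectionVars` is switched off for the theorem below (as in abc-iut-w4-d042's original, whose note follows): on this four-deep carrier its end-of-declaration analysis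
-- does not terminate in reasonable time (> 600 s on the farm; every other elaboration step of these declarations takes < 70 s, measured
-- 2026-08-26 by abc-iut-w4-d042 g7), while the only section instance it could report, `[RD.iotaN.range.Normal]`, IS used (through
-- `rowTwoPre_id_ofConnectedTemperoidData_levelN_galois`).  No statement is affected by the option.
set_option linter.unusedSectionVars false in
/-- **[EtTh] Lemma 5.9 (v) AT THE GENUINE §5 DATA over `B^temp(Π^tp_X)⁰` (level `N`, any Frobenius-trivial Galois `A_⊙`), RE-KEYED to the v2
subquotient record `P : ThetaSubquotientProjGalois _ Gal`** (abc-iut-w4-d042's carrier head `cycRigidityCoincide_ofConnectedTemperoidData_levelN`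
(p471697) with the binder type changed and Prop. 5.5 read on the v2 record; everything else VERBATIM, BY NAME): in the situation of
Lemma 5.9 (iv) (`EnvIsoBiTheta`, BY NAME), for every rigidity family `ρ` Kummer-determined at `B_N` w.r.t. the pinned `P` (Prop. 5.5 BY NAME) and
every `ψ : (l·Δ_Θ)_{B_N} ⊗ ℤ/Nℤ ⥲ μ_N` satisfying the §2 law `ψ[proj(ρ k)] = θ-mod(k)` on `Π^tp_Ÿ ∩ (l·Δ_Θ)`:
`ρ_{B_N} = ψ ≫ m_i⁻¹` (`CycRigidityCoincide (rho219OfBiTheta ψ) ρ hB`).  The row-2 laws `hpre`/`hlift` are THEOREMS through `hPpre`.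
[cite: MochizukiEtTh2009, Lem 5.9 (v) p.332 (PDF p.106)] -/
theorem cycRigidityCoincide_ofConnectedTemperoidData_levelN_galois
    (h1 : (ofConnectedTemperoidData h (RD.levelStub ιX) odd_l R ιX K' constEmb constEmb_injective hinvc hinvp).SectionsFactor) (h3 : (ofConnectedTemperoidData h (RD.levelStub ιX) odd_l R ιX K' constEmb constEmb_injective hinvc hinvp).OuterActionLZ) (hsec : (ofConnectedTemperoidData h (RD.levelStub ιX) odd_l R ιX K' constEmb constEmb_injective hinvc hinvp).SgpCapSection) (hcs : (ofConnectedTemperoidData h (RD.levelStub ιX) odd_l R ιX K' constEmb constEmb_injective hinvc hinvp).SgpCupSection)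
    (h8 : (ofConnectedTemperoidData h (RD.levelStub ιX) odd_l R ιX K' constEmb constEmb_injective hinvc hinvp).ConstantsEqNormalizer) (DK : Set (TopOut (ofConnectedTemperoidData h (RD.levelStub ιX) odd_l R ιX K' constEmb constEmb_injective hinvc hinvp).EPiN))
    (h59iv : (ofConnectedTemperoidData h (RD.levelStub ιX) odd_l R ιX K' constEmb constEmb_injective hinvc hinvp).EnvIsoBiTheta h1 h3 hsec hcs h8 DK RD.toThetaEnvData (ContinuousMulEquiv.refl _))
    (hB : (ofConnectedTemperoidData h (RD.levelStub ιX) odd_l R ιX K' constEmb constEmb_injective hinvc hinvp).IsThetaSaturated (ofConnectedTemperoidData h (RD.levelStub ιX) odd_l R ιX K' constEmb constEmb_injective hinvc hinvp).BN) (P : ThetaSubquotientProjGalois (ofConnectedTemperoidData h (RD.levelStub ιX) odd_l R ιX K' constEmb constEmb_injective hinvc hinvp) Gal)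
    (hPpre : P.pre R.BN.base =
      (ThetaSubquotient.autPre (RD.qN ιX) RD.iotaN R.BN.base.obj).comap (Functor.mapAut R.BN.base (connectedObjects (BTemp X.Pi)).ι))
    (ρ : RigidityFamily (ofConnectedTemperoidData h (RD.levelStub ιX) odd_l R ιX K' constEmb constEmb_injective hinvc hinvp)) (hρ : P.IsKummerDetermined ρ hB)
    (ψ : (ofConnectedTemperoidData h (RD.levelStub ιX) odd_l R ιX K' constEmb constEmb_injective hinvc hinvp).lDeltaModN (ofConnectedTemperoidData h (RD.levelStub ιX) odd_l R ιX K' constEmb constEmb_injective hinvc hinvp).BN ≃* RD.mu)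
    (hψ : ∀ (k : RD.PiYdd) (hk : (k : RD.PiX) ∈ RD.lDeltaTheta) (hm : rhoOfBiKummerData R ιX k ∈ P.pre _),
      ψ (QuotientGroup.mk (P.proj _ ⟨rhoOfBiKummerData R ιX k, hm⟩) : (ofConnectedTemperoidData h (RD.levelStub ιX) odd_l R ιX K' constEmb constEmb_injective hinvc hinvp).lDeltaModN (ofConnectedTemperoidData h (RD.levelStub ιX) odd_l R ιX K' constEmb constEmb_injective hinvc hinvp).BN) = RD.thetaMod ⟨k, hk⟩) :
    (ofConnectedTemperoidData h (RD.levelStub ιX) odd_l R ιX K' constEmb constEmb_injective hinvc hinvp).CycRigidityCoincide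
      ((ofConnectedTemperoidData h (RD.levelStub ιX) odd_l R ιX K' constEmb constEmb_injective hinvc hinvp).rho219OfBiTheta h1 h3 hsec hcs h8 DK RD.toThetaEnvData (ContinuousMulEquiv.refl _) h59iv.2.2.choose_spec.choose
        h59iv.2.2.choose_spec.choose_spec.choose h59iv.2.2.choose_spec.choose_spec.choose_spec.1 ψ) ρ hB :=
  cycRigidityCoincide_rho219_of_envIsoBiTheta_of_rowTwo_galois.{max u₀ w', max u₀ w', u₀, max (u₀ + 1) w', u₀ + 1} (ofConnectedTemperoidData h (RD.levelStub ιX) odd_l R ιX K' constEmb constEmb_injective hinvc hinvp) h1 h3 hsec hcs h8 DK RD _ h59iv P ρ hB hρ ψ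
    (rowTwoPre_id_ofConnectedTemperoidData_levelN_galois.{u₀, v₀, w'} h odd_l R ιX K' constEmb constEmb_injective hinvc hinvp P hPpre)
    (rowTwoLift_id_ofConnectedTemperoidData_levelN_galois.{u₀, v₀, w'} h odd_l R ιX K' constEmb constEmb_injective hinvc hinvp P hPpre)
    (rowTwoLaw_id_ofConnectedTemperoidData_levelN_galois.{u₀, v₀, w'} h odd_l R ιX K' constEmb constEmb_injective hinvc hinvp P ψ hψ)


end Connected

end ThetaFrobenioid

end Literature.AnabelianGeometry.EtaleTheta

end
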